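import Summits.CriticalPhenomena.CardyFormulaZ2.Theorems.CardyTensorRGPolyominoGaussianLawSquareLimitPart2
import Summits.CriticalPhenomena.CardyFormulaZ2.Theorems.CardyTensorRGPolyominoGaussianLawDyadicCores

/-!
# The bond-`ℤ²` crossing probability of the unit square tends to `1/2` — Part 3: the theorem
# (crux `PolyominoGaussianLaw`, stmt-CriticalPhenomena-14337, route `CardyTensorRG`, line `registered`)

**Theorem (`sq_unitSquare_tendsto_half`).** For every conformal rectangle `R` whose carrier is the
open unit square `(0,1)²` and whose arcs `0`, `2` are two opposite sides (left/right or bottom/top),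
the bond-`ℤ²` crossing probability `bondDomainCrossingProb R δ` (H21's discretisation at mesh `δ`,
`p = 1/2`) tends to `1/2` as `δ → 0⁺`.

So the unit square (and, by the line's exact scaling identity, every lattice square) is the first
polyomino conformal rectangle for which BOTH open cores of the line hold as theorems
(`stub_unitSquareCores`, registered helper): its dyadic — indeed all — crossing limits EXIST, and
equal `1/2 = I_a(1/2)` for every exponent `a` (the square has cross-ratio `1/2` by symmetry).

Proof. Along the meshes `1/(n+2)` the left–right probability IS `crossingProb half n n`
(`RectangleDuality.bond_lr_eq`) `→ 1/2` (Part 2, `sq_tendsto_crossingProb_self`: self-duality below,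
Schramm–Smirnov continuity above); the bottom–top one is squeezed between
`crossingProb half n (n-1) = 1/2` and `crossingProb half n n` (`RectangleDuality.le_bond_bt`,
`bond_bt_le`). The meshes `1/(q·2^k)` are among these, and the line's log-scale net lemma
`tendsto_nhdsWithin_zero_of_orbits` with the mesh equicontinuity of polyomino crossing probabilities
(`stub_meshEquicontinuity`, the unit square being a polyomino with lattice marks,
`sq_exists_unitSquareLR/BT`) upgrades the sequential limit to `δ → 0⁺`; finally the crossing
probability depends on `R` only through its carrier and arcs `0`, `2`.
-/

noncomputable section

open Set Metric Complex MeasureTheory Filter Topology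
open scoped unitInterval
open Literature.Probability.LatticeModels Literature.Probability.Percolation
open Literature.Probability.RandomPlanarGeometry (ConformalRectangle)
open Summit.CriticalPhenomena.CardyFormulaZ2.Cruxes.SimilarityUpgrade.Stubs.RectangleDuality

namespace Summit.CriticalPhenomena.CardyFormulaZ2.Cruxes.PolyominoGaussianLaw.Birth

/-! ### Along the meshes `1/(n+2)` -/

/-- Left-to-right: `bond R (1/(n+2)) = crossingProb half n n → 1/2`. [folklore] -/
theorem sq_tendsto_bond_LR_mesh (R : ConformalRectangle) (hRc : R.carrier = Ioo (0 : ℝ) 1 ×ℂ Ioo (0 : ℝ) 1)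
    (hR0 : R.arc 0 = {z : ℂ | z.re = 0 ∧ z.im ∈ Icc (0 : ℝ) 1})
    (hR2 : R.arc 2 = {z : ℂ | z.re = 1 ∧ z.im ∈ Icc (0 : ℝ) 1}) :
    Tendsto (fun n : ℕ => bondDomainCrossingProb R (1 / ((n : ℝ) + 2))) atTop (𝓝 (1 / 2)) := by
  refine sq_tendsto_crossingProb_self.congr' ?_
  filter_upwards [eventually_ge_atTop 1] with n hn
  have hn2 : (0 : ℝ) < (n : ℝ) + 2 := by positivity
  have hδ : (0 : ℝ) < 1 / ((n : ℝ) + 2) := by positivity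
  have hnδ : 1 / ((n : ℝ) + 2) * ((n : ℝ) + 2) = 1 := one_div_mul_cancel hn2.ne'
  exact (bond_lr_eq R hRc hR0 hR2 hδ (a := n) (b := n) (by nlinarith) (by linarith) hnδ hn).symm

/-- Bottom-to-top: `crossingProb half n (n-1) = 1/2 ≤ bond R (1/(n+2)) ≤ crossingProb half n n → 1/2`.
[folklore] -/
theorem sq_tendsto_bond_BT_mesh (R : ConformalRectangle) (hRc : R.carrier = Ioo (0 : ℝ) 1 ×ℂ Ioo (0 : ℝ) 1)
    (hR0 : R.arc 0 = {z : ℂ | z.im = 0 ∧ z.re ∈ Icc (0 : ℝ) 1})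
    (hR2 : R.arc 2 = {z : ℂ | z.im = 1 ∧ z.re ∈ Icc (0 : ℝ) 1}) :
    Tendsto (fun n : ℕ => bondDomainCrossingProb R (1 / ((n : ℝ) + 2))) atTop (𝓝 (1 / 2)) := by
  -- shift the index: `n = n' + 1`
  have hshift : Tendsto (fun n' : ℕ => bondDomainCrossingProb R (1 / (((n' + 1 : ℕ) : ℝ) + 2))) atTop
      (𝓝 (1 / 2)) := by
    have hup : Tendsto (fun n' : ℕ => crossingProb half (n' + 1) (n' + 1)) atTop (𝓝 (1 / 2)) :=
      sq_tendsto_crossingProb_self.comp (tendsto_add_atTop_nat 1)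
    refine tendsto_of_tendsto_of_tendsto_of_le_of_le' tendsto_const_nhds hup ?_ ?_
    · filter_upwards [eventually_ge_atTop 0] with n' _
      have hn2 : (0 : ℝ) < (n' : ℝ) + 1 + 2 := by positivity
      have hδ : (0 : ℝ) < 1 / ((n' : ℝ) + 1 + 2) := by positivity
      have hnδ : 1 / ((n' : ℝ) + 1 + 2) * ((n' : ℝ) + 1 + 2) = 1 := one_div_mul_cancel hn2.ne'
      have h := le_bond_bt R hRc hR0 hR2 hδ (a := n' + 1) (b := n' + 1) (a' := n')
        (by push_cast; nlinarith) (by push_cast; linarith) (by push_cast; linarith) le_rfl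
      rw [real_shift_tbCrossing, crossingProb_half_succ_self_holds] at h
      push_cast
      exact h
    · filter_upwards [eventually_ge_atTop 0] with n' _
      have hn2 : (0 : ℝ) < (n' : ℝ) + 1 + 2 := by positivity
      have hδ : (0 : ℝ) < 1 / ((n' : ℝ) + 1 + 2) := by positivity
      have hnδ : 1 / ((n' : ℝ) + 1 + 2) * ((n' : ℝ) + 1 + 2) = 1 := one_div_mul_cancel hn2.ne'
      have h := bond_bt_le R hRc hR0 hR2 hδ (a := n' + 1) (b := n' + 1)
        (by push_cast; nlinarith) (by push_cast; linarith) (by push_cast; linarith)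
      rw [real_shift_tbCrossing] at h
      push_cast
      exact h
  exact (tendsto_add_atTop_iff_nat 1).1 hshift

/-! ### From the meshes `1/(q·2^k)` to `δ → 0⁺` -/

/-- The unit square is a one-cell polyomino: `(0,1)² = interior ([0,1]²)` in the crux's spelling
with `δ₀ = 1`, `s = {(0,0)}`. [folklore] -/
theorem sq_unitSquare_eq_interior :
    (Ioo (0 : ℝ) 1 ×ℂ Ioo (0 : ℝ) 1) = interior (⋃ p ∈ ({((0 : ℤ), (0 : ℤ))} : Finset (ℤ × ℤ)),
      {z : ℂ | (1 : ℝ) * (p.1 : ℝ) ≤ z.re ∧ z.re ≤ 1 * ((p.1 : ℝ) + 1) ∧ 1 * (p.2 : ℝ) ≤ z.im ∧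
        z.im ≤ 1 * ((p.2 : ℝ) + 1)}) := by
  rw [Finset.set_biUnion_singleton]
  have e : {z : ℂ | (1 : ℝ) * (((0 : ℤ) : ℝ)) ≤ z.re ∧ z.re ≤ 1 * ((((0 : ℤ) : ℝ)) + 1) ∧
      1 * (((0 : ℤ) : ℝ)) ≤ z.im ∧ z.im ≤ 1 * ((((0 : ℤ) : ℝ)) + 1)} = Icc (0 : ℝ) 1 ×ℂ Icc (0 : ℝ) 1 := by
    ext z
    simp only [Int.cast_zero, mul_zero, zero_add, mul_one, mem_setOf_eq, mem_reProdIm, mem_Icc]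
    tauto
  rw [e, interior_reProdIm, interior_Icc]

/-- The sequential limits along all meshes `1/(n+2)` give the one-sided limit `δ → 0⁺` for a
polyomino conformal rectangle with lattice marks and carrier the unit square (net lemma + mesh
equicontinuity of the line). [folklore] -/
theorem sq_tendsto_of_mesh (R : ConformalRectangle) (hRc : R.carrier = Ioo (0 : ℝ) 1 ×ℂ Ioo (0 : ℝ) 1)
    (hpt : ∀ i, ∃ m n : ℤ, R.pt i = ((1 : ℝ) : ℂ) * ((m : ℂ) + (n : ℂ) * Complex.I)) {L : ℝ}
    (h : Tendsto (fun n : ℕ => bondDomainCrossingProb R (1 / ((n : ℝ) + 2))) atTop (𝓝 L)) :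
    Tendsto (bondDomainCrossingProb R) (𝓝[>] 0) (𝓝 L) := by
  have hpoly : ∃ δ₀ : ℝ, 0 < δ₀ ∧ (∃ s : Finset (ℤ × ℤ), R.carrier = interior (⋃ p ∈ s, {z : ℂ |
      δ₀ * (p.1 : ℝ) ≤ z.re ∧ z.re ≤ δ₀ * ((p.1 : ℝ) + 1) ∧ δ₀ * (p.2 : ℝ) ≤ z.im ∧
      z.im ≤ δ₀ * ((p.2 : ℝ) + 1)})) ∧ ∀ i, ∃ m n : ℤ, R.pt i = (δ₀ : ℂ) * ((m : ℂ) + (n : ℂ) * Complex.I) :=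
    ⟨1, one_pos, ⟨{((0 : ℤ), (0 : ℤ))}, hRc.trans sq_unitSquare_eq_interior⟩, hpt⟩
  refine tendsto_nhdsWithin_zero_of_orbits (δ₀ := 1) one_pos (fun q hq => ?_) (stub_meshEquicontinuity R hpoly)
  -- the orbit `1/(q·2^k)` is the subsequence `n = q·2^k - 2` of the meshes `1/(n+2)`
  have hq0 : 0 < q := hq
  have hsub : Tendsto (fun k : ℕ => q * 2 ^ k - 2) atTop atTop := by
    refine tendsto_atTop_atTop.2 fun b => ⟨b + 2, fun k hk => ?_⟩
    have h1 : k ≤ 2 ^ k := Nat.lt_two_pow_self.le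
    have h2 : 2 ^ k ≤ q * 2 ^ k := Nat.le_mul_of_pos_left _ hq0
    omega
  refine ((h.comp hsub).congr' ?_)
  filter_upwards [eventually_ge_atTop 1] with k hk
  have h2k : 2 ≤ q * 2 ^ k := by
    have h1 : 2 ≤ 2 ^ k := by
      calc 2 = 2 ^ 1 := by norm_num
        _ ≤ 2 ^ k := Nat.pow_le_pow_right (by norm_num) hk
    exact h1.trans (Nat.le_mul_of_pos_left _ hq0)
  simp only [Function.comp_apply]
  congr 1
  rw [Nat.cast_sub h2k]
  push_cast
  ring

/-! ### The theorem -/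

/-- **The bond-`ℤ²` crossing probability of the unit square tends to `1/2`.** For every conformal
rectangle `R` with carrier the open unit square and arcs `0`, `2` either the left and right sides or
the bottom and top sides, `bondDomainCrossingProb R δ → 1/2` as `δ → 0⁺`. [folklore] -/
theorem sq_unitSquare_tendsto_half (R : ConformalRectangle)
    (hRc : R.carrier = Ioo (0 : ℝ) 1 ×ℂ Ioo (0 : ℝ) 1)
    (harcs : (R.arc 0 = {z : ℂ | z.re = 0 ∧ z.im ∈ Icc (0 : ℝ) 1} ∧
        R.arc 2 = {z : ℂ | z.re = 1 ∧ z.im ∈ Icc (0 : ℝ) 1}) ∨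
      (R.arc 0 = {z : ℂ | z.im = 0 ∧ z.re ∈ Icc (0 : ℝ) 1} ∧
        R.arc 2 = {z : ℂ | z.im = 1 ∧ z.re ∈ Icc (0 : ℝ) 1})) :
    Tendsto (bondDomainCrossingProb R) (𝓝[>] 0) (𝓝 (1 / 2)) := by
  -- the crossing probability depends on `R` only through its carrier and arcs `0`, `2`
  have transfer : ∀ R' : ConformalRectangle, R'.carrier = R.carrier → R'.arc 0 = R.arc 0 →
      R'.arc 2 = R.arc 2 → bondDomainCrossingProb R = bondDomainCrossingProb R' := by
    intro R' h1 h2 h3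
    funext δ
    rw [bondDomainCrossingProb_eq_measureReal, bondDomainCrossingProb_eq_measureReal, h1, h2, h3]
  rcases harcs with ⟨hR0, hR2⟩ | ⟨hR0, hR2⟩
  · obtain ⟨R', hRc', hR0', hR2', hpt'⟩ := sq_exists_unitSquareLR
    rw [transfer R' (hRc'.trans hRc.symm) (hR0'.trans hR0.symm) (hR2'.trans hR2.symm)]
    exact sq_tendsto_of_mesh R' hRc' hpt' (sq_tendsto_bond_LR_mesh R' hRc' hR0' hR2')
  · obtain ⟨R', hRc', hR0', hR2', hpt'⟩ := sq_exists_unitSquareBT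
    rw [transfer R' (hRc'.trans hRc.symm) (hR0'.trans hR0.symm) (hR2'.trans hR2.symm)]
    exact sq_tendsto_of_mesh R' hRc' hpt' (sq_tendsto_bond_BT_mesh R' hRc' hR0' hR2')

/-- **Both cores of the line hold for the unit square** (registered helper stub
`stub_unitSquareCores`): for every conformal rectangle with carrier the open unit square and arcs
`0`, `2` two opposite sides, the bond-`ℤ²` crossing probabilities converge as `δ → 0⁺` — in
particular along every dyadic orbit `δ₀ · 2^(−k)` (dyadic LimitExists) — and the limit is
`1/2`, i.e. `I_a(1/2)` for every exponent `a` (identification; the square's cross-ratio is `1/2`).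
[folklore] -/
theorem stub_unitSquareCores :
    ∀ R : Literature.Probability.RandomPlanarGeometry.ConformalRectangle,
      R.carrier = (Set.Ioo (0 : ℝ) 1 ×ℂ Set.Ioo (0 : ℝ) 1) →
      ((R.arc 0 = {z : ℂ | z.re = 0 ∧ z.im ∈ Set.Icc (0 : ℝ) 1} ∧
          R.arc 2 = {z : ℂ | z.re = 1 ∧ z.im ∈ Set.Icc (0 : ℝ) 1}) ∨
        (R.arc 0 = {z : ℂ | z.im = 0 ∧ z.re ∈ Set.Icc (0 : ℝ) 1} ∧
          R.arc 2 = {z : ℂ | z.im = 1 ∧ z.re ∈ Set.Icc (0 : ℝ) 1})) →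
      Filter.Tendsto (Literature.Probability.Percolation.bondDomainCrossingProb R)
          (nhdsWithin 0 (Set.Ioi 0)) (nhds (1 / 2)) ∧
        ∀ δ₀ : ℝ, 0 < δ₀ → Filter.Tendsto
          (fun k : ℕ => Literature.Probability.Percolation.bondDomainCrossingProb R (δ₀ / 2 ^ k))
          Filter.atTop (nhds (1 / 2)) := by
  intro R hRc harcs
  have h := sq_unitSquare_tendsto_half R hRc harcs
  exact ⟨h, fun δ₀ hδ₀ => h.comp (tendsto_dyadicMesh hδ₀)⟩

end Summit.CriticalPhenomena.CardyFormulaZ2.Cruxes.PolyominoGaussianLaw.Birth
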